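import Summits.KontsevichZagierPeriods.KontsevichZagierPeriods.Theorems.SoloInformedRealParamBarrier
import Literature.NumberTheory.Transcendental.BoundedPeriodComputable
import Literature.Barriers.KontsevichZagierPeriods.GrothendieckPeriodConjectureDependenceProofs
import HarnessLib

/-!
# A hypothesis-free instance of THEOREM R: `log 2` versus the real rectangles

The bounded `ℚ`-representation `A = [{1 ≤ x ≤ 2, 0 < t < 1/x}, 1]` of `KZ_ℚ` has value `log 2`
(area under the hyperbola; Fubini via `KZ.IntegralRep.volume_subgraph_eq`), and `log 2` is
transcendental (Hermite–Lindemann, the tree's `transcendental_log_ratCast`).  Hence, by the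
unconditional THEOREM R for bounded chains (`soloInformed_realParameterBarrier`), `A` is **not**
boundedly `KZ_ℝ`-equivalent to any rectangle `[[0,1] × [0,ℓ], 1]` — in particular not to the one
with `ℓ = log 2`, although both have the same value: bounded chains of the four KZ moves with
*real*-semialgebraic data never connect a transcendental `ℚ`-period to a real rectangle.

References: M. Kontsevich, D. Zagier, *Periods* (2001), §1.1–1.2; J. Fresán, *Une introduction aux
périodes* (2024), Ex. 2.5 (Hermite–Lindemann for `log q`).
-/

open Set MeasureTheory MvPolynomial Literature.ModelTheory.ExponentialFields
open Literature.NumberTheory.Transcendental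

namespace Summit.KontsevichZagierPeriods.KontsevichZagierPeriods.Theorems

/-! ### The representation `A_{log 2}` -/

/-- The base `[1, 2] ⊆ ℝ¹` of the hyperbola solid. [cite: KontsevichZagier2001, §1.1] -/
def soloInformedLogTwoBase : Set (Fin 1 → ℝ) := Set.pi univ fun _ => Icc (1 : ℝ) 2

/-- Membership in the base. [cite: KontsevichZagier2001, §1.1] -/
theorem soloInformed_mem_logTwoBase_iff (u : Fin 1 → ℝ) :
    u ∈ soloInformedLogTwoBase ↔ 1 ≤ u 0 ∧ u 0 ≤ 2 := by
  simp only [soloInformedLogTwoBase, mem_univ_pi, mem_Icc, Fin.forall_fin_one]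

/-- The hyperbola solid `{(x, t) | 1 ≤ x ≤ 2, 0 < t < 1/x} ⊆ ℝ²`, written as the strict subgraph
of `x ↦ 1/x` over the base. [cite: KontsevichZagier2001, §1.1] -/
def soloInformedLogTwoDomain : Set (Fin 2 → ℝ) :=
  {v | Fin.init v ∈ soloInformedLogTwoBase ∧ 0 < v (Fin.last 1) ∧
    v (Fin.last 1) < ((Fin.init v) 0)⁻¹}

/-- Membership in the hyperbola solid by polynomial inequalities.
[cite: KontsevichZagier2001, §1.1] -/
theorem soloInformed_mem_logTwoDomain_iff (v : Fin 2 → ℝ) :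
    v ∈ soloInformedLogTwoDomain ↔ (1 ≤ v 0 ∧ v 0 ≤ 2) ∧ 0 < v 1 ∧ v 1 * v 0 < 1 := by
  have h0 : Fin.init v 0 = v 0 := rfl
  have h1 : v (Fin.last 1) = v 1 := rfl
  simp only [soloInformedLogTwoDomain, mem_setOf_eq, soloInformed_mem_logTwoBase_iff, h0, h1]
  constructor
  · rintro ⟨hb, ht, hlt⟩
    have hx : 0 < v 0 := lt_of_lt_of_le one_pos hb.1
    exact ⟨hb, ht, by rwa [← one_div, lt_div_iff₀ hx] at hlt⟩
  · rintro ⟨hb, ht, hlt⟩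
    have hx : 0 < v 0 := lt_of_lt_of_le one_pos hb.1
    exact ⟨hb, ht, by rwa [← one_div, lt_div_iff₀ hx]⟩

/-- The hyperbola solid is `ℚ`-semialgebraic. [cite: BochnakCosteRoy1998, §2.1] -/
theorem soloInformed_isSemialgebraic_logTwoDomain :
    IsSemialgebraic ℚ soloInformedLogTwoDomain := by
  have hset : soloInformedLogTwoDomain =
      (({v : Fin 2 → ℝ | aeval v (1 : MvPolynomial (Fin 2) ℚ) ≤
            aeval v (X 0 : MvPolynomial (Fin 2) ℚ)}
        ∩ {v | aeval v (X 0 : MvPolynomial (Fin 2) ℚ) ≤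
            aeval v (C 2 : MvPolynomial (Fin 2) ℚ)})
        ∩ {v | aeval v (0 : MvPolynomial (Fin 2) ℚ) < aeval v (X 1 : MvPolynomial (Fin 2) ℚ)})
        ∩ {v | aeval v (X 1 * X 0 : MvPolynomial (Fin 2) ℚ) <
            aeval v (1 : MvPolynomial (Fin 2) ℚ)} := by
    ext v
    simp only [soloInformed_mem_logTwoDomain_iff, mem_inter_iff, mem_setOf_eq, map_one, aeval_X,
      aeval_C, map_zero, map_mul, eq_ratCast, Rat.cast_ofNat, and_assoc]
  rw [hset]
  exact (((isSemialgebraic_setOf_eval_le _ _).inter (isSemialgebraic_setOf_eval_le _ _)).inter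
    (isSemialgebraic_setOf_eval_lt _ _)).inter (isSemialgebraic_setOf_eval_lt _ _)

/-- `∫_{[1,2]} dx/x = log 2` over the base `ℝ¹`. [cite: KontsevichZagier2001, §1.1] -/
theorem soloInformed_setIntegral_logTwoBase_inv :
    ∫ u in soloInformedLogTwoBase, (u 0)⁻¹ = Real.log 2 := by
  have he : MeasurePreserving (MeasurableEquiv.funUnique (Fin 1) ℝ) volume volume :=
    volume_preserving_funUnique (Fin 1) ℝ
  have hpre : soloInformedLogTwoBase = MeasurableEquiv.funUnique (Fin 1) ℝ ⁻¹' Icc 1 2 := by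
    ext u
    simp only [soloInformed_mem_logTwoBase_iff, mem_preimage, mem_Icc]
    exact Iff.rfl
  have h1 : ∫ u in soloInformedLogTwoBase, (u 0)⁻¹ = ∫ t in Icc (1 : ℝ) 2, t⁻¹ := by
    rw [hpre]
    exact he.setIntegral_preimage_emb (MeasurableEquiv.funUnique (Fin 1) ℝ).measurableEmbedding
      (fun t : ℝ => t⁻¹) (Icc 1 2)
  have h0 : (0 : ℝ) ∉ uIcc (1 : ℝ) 2 := by
    rw [uIcc_of_le one_le_two, mem_Icc, not_and_or, not_le]
    exact Or.inl one_pos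
  rw [h1, integral_Icc_eq_integral_Ioc, ← intervalIntegral.integral_of_le one_le_two,
    integral_inv h0, div_one]

/-- **`vol A_{log 2} = log 2`** (Fubini: the area under the hyperbola over `[1, 2]`).
[cite: KontsevichZagier2001, §1.1] -/
theorem soloInformed_volume_logTwoDomain :
    volume soloInformedLogTwoDomain = ENNReal.ofReal (Real.log 2) := by
  have hσ : MeasurableSet soloInformedLogTwoBase :=
    MeasurableSet.univ_pi fun _ => measurableSet_Icc
  have hpos : ∀ u ∈ soloInformedLogTwoBase, 0 < u 0 := fun u hu =>
    lt_of_lt_of_le one_pos ((soloInformed_mem_logTwoBase_iff u).1 hu).1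
  have hfm : Measurable (soloInformedLogTwoBase.indicator fun u : Fin 1 → ℝ => (u 0)⁻¹) :=
    ((measurable_pi_apply 0).inv).indicator hσ
  have hcont : ContinuousOn (fun u : Fin 1 → ℝ => (u 0)⁻¹) soloInformedLogTwoBase :=
    (continuous_apply 0).continuousOn.inv₀ fun u hu => (hpos u hu).ne'
  have hf : IntegrableOn (fun u : Fin 1 → ℝ => (u 0)⁻¹) soloInformedLogTwoBase :=
    hcont.integrableOn_compact (isCompact_univ_pi fun _ => isCompact_Icc)
  have h := KZ.IntegralRep.volume_subgraph_eq hσ hfm hf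
  rw [soloInformedLogTwoDomain, h, ← soloInformed_setIntegral_logTwoBase_inv]
  congr 1
  refine setIntegral_congr_fun hσ fun u hu => ?_
  exact max_eq_left (inv_pos.2 (hpos u hu)).le

/-- **The representation `A_{log 2} = [{1 ≤ x ≤ 2, 0 < t < 1/x}, 1]` of `KZ_ℚ`.**
[cite: KontsevichZagier2001, §1.1] -/
noncomputable def soloInformedLogTwoRep : KZOver.IntegralRep ℚ 2 where
  domain := soloInformedLogTwoDomain
  integrand _ := 1
  isSemialgebraic_domain := soloInformed_isSemialgebraic_logTwoDomain
  isSemialgebraicFunOn_integrand :=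
    (isSemialgebraicFunOn_aeval soloInformed_isSemialgebraic_logTwoDomain
      (1 : MvPolynomial (Fin 2) ℚ)).congr fun x _ => by simp
  integrableOn := (integrableOn_const_iff).2
    (Or.inr (by rw [soloInformed_volume_logTwoDomain]; exact ENNReal.ofReal_lt_top))

/-- **`value A_{log 2} = log 2`.** [cite: KontsevichZagier2001, §1.1] -/
theorem soloInformed_value_logTwoRep : soloInformedLogTwoRep.value = Real.log 2 := by
  rw [KZOver.IntegralRep.value]
  show ∫ _ in soloInformedLogTwoDomain, (1 : ℝ) = Real.log 2
  rw [setIntegral_const, smul_eq_mul, mul_one, Measure.real, soloInformed_volume_logTwoDomain,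
    ENNReal.toReal_ofReal (Real.log_nonneg one_le_two)]

/-- `A_{log 2}` is bounded (it lies in `[0, 2]²`, integrand `1`).
[cite: KontsevichZagier2001, §1.1] -/
theorem soloInformedBddRep_logTwoRep : SoloInformedBddRep soloInformedLogTwoRep := by
  refine ⟨2, fun x hx i => ?_, fun x _ => ?_⟩
  · have hx' := (soloInformed_mem_logTwoDomain_iff x).1 hx
    have h0 : 0 < x 0 := lt_of_lt_of_le one_pos hx'.1.1
    have h1 : x 1 ≤ 2 := by
      have : x 1 < 1 := by
        have h := hx'.2.2
        calc x 1 = x 1 * x 0 * (x 0)⁻¹ := by field_simp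
          _ < 1 * (x 0)⁻¹ := by gcongr
          _ ≤ 1 := by rw [one_mul]; exact inv_le_one_of_one_le₀ hx'.1.1
      linarith
    fin_cases i
    · simpa [abs_of_pos h0] using hx'.1.2
    · simpa [abs_of_pos hx'.2.1] using h1
  · show |(1 : ℝ)| ≤ 2
    norm_num

/-- **`log 2` is transcendental** (Hermite–Lindemann), as the value of `A_{log 2}`.
[cite: Fresan2024, Ex. 2.5] -/
theorem soloInformed_transcendental_value_logTwoRep :
    Transcendental ℚ soloInformedLogTwoRep.value := by
  rw [soloInformed_value_logTwoRep]
  have h := Literature.Barriers.KontsevichZagierPeriods.transcendental_log_ratCast 2 two_pos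
    (by norm_num)
  simpa only [Rat.cast_ofNat] using h

/-! ### The instance of THEOREM R -/

/-- **`A_{log 2}` minus any rectangle is not a bounded real relation**: for `0 ≤ ℓ`,
`[A_{log 2}] - [[0,1] × [0,ℓ], 1] ∉ relationsBdd ℝ` — unconditionally.
[cite: KontsevichZagier2001, §1.2 Conjecture 1] -/
theorem soloInformed_logTwoRep_sub_rect_notMem_relationsBdd {ℓ : ℝ} (hℓ : 0 ≤ ℓ) :
    KZOver.of (soloInformedLogTwoRep.baseChange ℝ) - KZOver.of (soloInformedRealRect ℓ) ∉
      soloInformedRelationsBdd ℝ :=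
  soloInformed_realParameterBarrier soloInformedLogTwoRep soloInformedBddRep_logTwoRep
    soloInformed_transcendental_value_logTwoRep hℓ

/-- **`A_{log 2}` is not boundedly `KZ_ℝ`-equivalent to any rectangle `[[0,1] × [0,ℓ], 1]`**, in
particular not to the one of area `log 2`: no bounded chain of the four KZ moves with
real-semialgebraic data connects them. [cite: KontsevichZagier2001, §1.2 Conjecture 1] -/
theorem soloInformed_logTwoRep_not_bddEquivalent_rect (ℓ : ℝ) :
    ¬ SoloInformedBddEquivalent (soloInformedLogTwoRep.baseChange ℝ) (soloInformedRealRect ℓ) :=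
  soloInformed_realParameterBarrier' soloInformedLogTwoRep soloInformedBddRep_logTwoRep
    soloInformed_transcendental_value_logTwoRep ℓ

/-- The two representations nevertheless have the same value `log 2` (for `ℓ = log 2`): the
obstruction is to the *chain*, not to the equality of periods. [cite: KontsevichZagier2001, §1.1] -/
theorem soloInformed_value_logTwoRep_eq_value_rect :
    (soloInformedLogTwoRep.baseChange ℝ).value = (soloInformedRealRect (Real.log 2)).value := by
  rw [KZOver.IntegralRep.value_baseChange, soloInformed_value_logTwoRep,
    soloInformedRealRect_value (Real.log_nonneg one_le_two)]

end Summit.KontsevichZagierPeriods.KontsevichZagierPeriods.Theorems
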